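import Literature.NumberTheory.EllipticCurves.SkinnerUrban2014.ShapiroSelmerBigRep
import Literature.NumberTheory.EllipticCurves.Rank1Residual.Predicates
import HarnessLib

/-!
# Castella 2018, §2.2 / Erratum, proof of Lemma 2.1: for `Σ ⊇ {w ∤ p : T ramified at w}` the
# anticyclotomic Selmer group of `𝒜 = T_pE ⊗ Λ^*` of Def. 2.2 (classes TRIVIAL at every finite
# `w ∉ Σ`, `w ∤ p`) is the `G_{K,S}`-kernel `ker{H¹(G_{K,S}, 𝒜) → H¹(K_𝔭, 𝒜)}` (classes UNRAMIFIED
# outside `S = Σ ∪ S_p`, strict at `𝔭`)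

Cell `bsd-stepL` (crux `stmt-BirchSwinnertonDyer-19270`, Road FF): the bridge between the two
formulations of `Sel^Σ_𝔭(K, T ⊗ Λ^*)` in the tree — `BigGaloisRep.selmerBigDecomp` (Cas18 Def. 2.2
literally) and `BigGaloisRep.selmerBig` (the erratum's `G_{K,S}`-kernel, inertia conditions at
`w ∉ S`) — for `T = T_pE`. ONE named fact (printed, with the source's one-line justification), and
PROVED corollaries combining it with Shapiro [SU14, Prop. 3.2.3]
(`SkinnerUrban2014.prop323_XAc_equiv_XBigDecomp`) into the hypothesis `hSh` of the kernel glue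
`Summit.….XAc.map_charIdeal_le_span_of_roadFF_unr_le` with the INERTIA strict set `strictSet p 𝔭 Σ`
(the set on which its local torsion-control hypotheses hold). No `sorry`.

## Source, verbatim

* F. Castella, Camb. J. Math. 6 (2018) (arXiv:1704.06608v2/v3 TeX, §2.2, held chunk p0007): "Note
  that directly from the definition we have an exact sequence
  `0 → Sel_𝔭(K_∞, E[p^∞]) → 𝔖el_Gr(K_∞, E[p^∞]) → ℋ^ur_𝔭 ⊕ ∏_{w∤p} ℋ^ur_w` (eq:defs), where
  `ℋ^ur_v = ker{H¹(K_v, M) → H¹(I_v, M)}` is the set of unramified cocycles. … For primes `v ∤ p`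
  which are split in `K`, it is easy to see that the restriction map `H¹(K_v, M) → H¹(I_v, M)` is
  injective (see [PW11]), and so `ℋ^ur_v` vanishes. … Now, a straightforward modification of the
  argument in [PW11] shows that `ℋ^ur_w ≃ (ℤ_p/p^{t_E(w)}ℤ_p) ⊗ Λ^*`, where
  `t_E(w) := ord_p(c_w(E/K))` is the `p`-exponent of the Tamagawa number of `E` at `w`" [so
  `ℋ^ur_w = 0` at every nonsplit `w ∤ p` of good reduction, `c_w = 1`]; Theorem 2.6: "Let `S_p` be
  the places of `K` above `p`, and assume that `Σ ∪ S_p` contains all places of `K` at which `T` is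
  ramified", and in its proof: "Note that our assumption on `S := Σ ∪ S_p` implies that
  `Sel^Σ_𝔭(K_∞, M_?) = ker{H¹(G_{K,S}, M_?) → H¹(K_𝔭, M_?)/H¹_Gr(K_𝔭, M_?)}`, where …
  `G_{K,S}` is the Galois group of the maximal extension of `K` unramified outside `S`".
  Standing hypotheses of §2 (p. 4): `p ≥ 5`, `ρ̄_{E,p}` irreducible, `K` imaginary quadratic with
  `p = 𝔭𝔭̄` split, `Γ = Gal(K_∞/K)` anticyclotomic.
* F. Castella, Erratum, proof of Lemma 2.1 (p. 2): "Suppose `Σ` contains all primes `v ∤ p` where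
  `T_g` is ramified … Let `S_p` be the set of primes of `K` above `p`, put `S = Σ ∪ S_p`, and denote
  by `G_{K,S}` the Galois group of the maximal algebraic extension of `K` unramified outside `S`. By
  our assumption on `Σ`, the Selmer groups `Sel^Σ_𝔭(K, M_g)` and `Sel^Σ_𝔭(K, M_g[ϖ^m])` are
  submodules of `H¹(G_{K,S}, M_g)` and `H¹(G_{K,S}, M_g[ϖ^m])` … By definition, under the above
  identification `Sel^Σ_𝔭(K, M_g)[ϖ^m]` is the kernel of the composite map
  `H¹(G_{K,S}, M_g[p^m]) → H¹(K_𝔭, M_g[ϖ^m]) → H¹(K_𝔭, M_g)[ϖ^m]`."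

## Transcription

`H¹(G_{K,S}, 𝒜) ⊆ H¹(K, 𝒜)` is the submodule of classes unramified at every finite `w ∉ S`
(inflation; `𝒜` is unramified outside `S` by the assumption on `Σ` and because `K_∞/K` is
unramified outside `p`), so the printed identification reads, in the tree's vocabulary
(`BigGaloisRepSelmer.lean`): the classes of `H¹(Γ_K, 𝒜)` dying in `H¹(K_𝔮, 𝒜)` at `𝔮 = 𝔭` and in
`H¹(K_w, 𝒜)` at every finite `w ∉ Σ`, `w ∤ p` (`selmerBigDecomp`, strict set `strictSetDecomp`) are
exactly those dying in `H¹(K_𝔭, 𝒜)` and in `H¹(I_w, 𝒜)` at those `w` (`selmerBig`, strict set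
`strictSet`), for `𝒜 = (W.baseChange K).anticyclotomicBigRep p κ` and `Σ ⊇ {w ∤ p : T_pE|_{Γ_K}`
`ramified at w}` ("ramified at `w`": the inertia group `I_w ⊂ Γ_K` — image of
`localMap K (Sum.inr w)` — acts non-trivially on `E[p^∞]`). The inclusion `⊆` is formal; `⊇` is the
vanishing `ℋ^ur_w(𝒜) = 0` at good `w ∉ Σ` quoted above. Not proved here (the tree has the local
ingredients — `absInertia`, Frobenius lifts, `cd ≤ 1` of `Gal(F̄/F^nr)` — but not yet
`H¹(Γ_F/I_F, M) = M/(Frob − 1)M` for discrete torsion `M`).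

References: [Castella2018] §2.2 ((eq:defs), the two sentences on `ℋ^ur`, Prop. 2.5), Thm. 2.6 and
its proof (the `G_{K,S}` display); [Castella2018Erratum] §2, proof of Lemma 2.1 (p. 2);
[PollackWeston2011AMU] (as cited by [Cas18] for `ℋ^ur`); [SkinnerUrban2014] §3.1.3 (p. 18: "If `Σ`
contains all the places at which `T` is ramified and all the places over `p`, then
`Sel^Σ_F(T) = ker{H¹(G_{F,Σ}, T ⊗_A A^*) → ∏_{v∣p} …}`").
-/

noncomputable section

open Field IsDedekindDomain NumberField WeierstrassCurve
open Literature.NumberTheory.EllipticCurves Literature.NumberTheory.EllipticCurves.BigGaloisRep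
open Literature.NumberTheory.EllipticCurves.Rank1Residual
open Literature.NumberTheory.GaloisRepresentations

namespace Literature.NumberTheory.EllipticCurves.Castella2018

/-- **Castella 2018 §2.2 / Erratum proof of Lemma 2.1 — `Sel^Σ_𝔭(K, 𝒜)` of Def. 2.2 equals the
`G_{K,S}`-kernel when `Σ ⊇ {w ∤ p : T ramified at w}`**, for `𝒜 = T_pE ⊗_{ℤ_p} Λ^*(Ψ⁻¹)`
(`(W.baseChange K).anticyclotomicBigRep p κ`): for `E/ℚ` an elliptic curve, `p ≥ 5` with `ρ̄_{E,p}`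
irreducible, `K` an imaginary quadratic field in which `p` splits, `𝔭 ∣ p`, `κ` the anticyclotomic
`ℤ_p`-extension, and `Σ` a finite set of primes `w ∤ p` of `K` containing every `w ∤ p` at which
`T_pE|_{Γ_K}` is ramified, the two strict sets define the same Selmer group:
`selmerBig κ ρ_{E,p} 𝔭 Σ = selmerBigDecomp κ ρ_{E,p} 𝔭 Σ` ("By our assumption on `Σ`, the Selmer
groups `Sel^Σ_𝔭(K, M)` … are submodules of `H¹(G_{K,S}, M)` … `Sel^Σ_𝔭 = ker{H¹(G_{K,S}, M) →
H¹(K_𝔭, M)}`"; the content is `ℋ^ur_w(𝒜) = 0` at the good `w ∉ Σ`: "`ℋ^ur_v` vanishes" at split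
`v ∤ p`, "`ℋ^ur_w ≃ (ℤ_p/p^{t_E(w)}) ⊗ Λ^*`", `t_E(w) = ord_p c_w(E/K) = 0` at nonsplit good `w`).
Stated for every topology on `Λ` making the action continuous (the groups do not depend on it).
[cite: Castella2018, §2.2 ((eq:defs) and the two sentences on ℋ^ur_v, ℋ^ur_w after Prop. 2.5) and Thm. 2.6 with its proof ("our assumption on S := Σ ∪ S_p implies Sel^Σ_𝔭(K_∞, M) = ker{H¹(G_{K,S}, M) → …}")]
[cite: Castella2018Erratum, §2, proof of Lemma 2.1 (p. 2, "By our assumption on Σ … submodules of H¹(G_{K,S}, M_g) … Sel^Σ_𝔭(K,M_g)[ϖ^m] is the kernel of H¹(G_{K,S}, M_g[p^m]) → H¹(K_𝔭, …)")] -/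
def selmerBig_eq_selmerBigDecomp_of_unramifiedOutside : Prop :=
  ∀ (W : WeierstrassCurve ℚ) [W.IsElliptic] (p : ℕ) [Fact p.Prime], 5 ≤ p → Irr W p →
    ∀ (K : Type) [Field K] [NumberField K], IsImaginaryQuadratic K →
      SatisfiesHeegnerHypothesis p K →
    ∀ (𝔭 : HeightOneSpectrum (𝓞 K)), ((p : ℕ) : 𝓞 K) ∈ 𝔭.asIdeal →
    ∀ (S : Set (HeightOneSpectrum (𝓞 K))), S.Finite → (∀ w ∈ S, ((p : ℕ) : 𝓞 K) ∉ w.asIdeal) →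
      -- "`Σ` contains all primes `v ∤ p` where `T` is ramified": at `w ∉ Σ`, `w ∤ p`, the inertia
      -- group `I_w ⊂ Γ_K` acts trivially on `E[p^∞] = E(K̄)[p^∞]`
      (∀ w : HeightOneSpectrum (𝓞 K), w ∉ S → ((p : ℕ) : 𝓞 K) ∉ w.asIdeal →
        ∀ (σ : LocalGroup K (Sum.inr w)) (P : PrimaryTorsion (geomPoints (W.baseChange K)) p),
          (W.baseChange K).primaryTorsionGaloisRep p (localMap K (Sum.inr w) σ) P = P) →
    ∀ (κ : ZpExtension K p), κ.IsAnticyclotomic →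
    ∀ [TopologicalSpace (IwasawaAlgebra p)]
      [ContinuousSMul (IwasawaAlgebra p)
        (BigRepModule ℤ_[p] p (PrimaryTorsion (geomPoints (W.baseChange K)) p))],
      selmerBig κ ((W.baseChange K).primaryTorsionGaloisRep p) 𝔭 S =
        selmerBigDecomp κ ((W.baseChange K).primaryTorsionGaloisRep p) 𝔭 S

/-! ### Proved corollaries: `X^Σ_ac(E[p^∞])` versus the `G_{K,S}`-formulated dual `XBig` -/

section Corollaries

variable (W : WeierstrassCurve ℚ) [W.IsElliptic] (p : ℕ) [Fact p.Prime] (hp : 5 ≤ p) (hirr : Irr W p)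
  (K : Type) [Field K] [NumberField K] (hK : IsImaginaryQuadratic K)
  (hsplit : SatisfiesHeegnerHypothesis p K)
  (𝔭 : HeightOneSpectrum (𝓞 K)) (h𝔭 : ((p : ℕ) : 𝓞 K) ∈ 𝔭.asIdeal)
  (S : Set (HeightOneSpectrum (𝓞 K))) (hS : S.Finite) (hSp : ∀ w ∈ S, ((p : ℕ) : 𝓞 K) ∉ w.asIdeal)
  (hram : ∀ w : HeightOneSpectrum (𝓞 K), w ∉ S → ((p : ℕ) : 𝓞 K) ∉ w.asIdeal →
    ∀ (σ : LocalGroup K (Sum.inr w)) (P : PrimaryTorsion (geomPoints (W.baseChange K)) p),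
      (W.baseChange K).primaryTorsionGaloisRep p (localMap K (Sum.inr w) σ) P = P)
  (κ : ZpExtension K p) (hκ : κ.IsAnticyclotomic)
  (γ : absoluteGaloisGroup K) [Fact (κ.IsTopGenerator γ)]
  [TopologicalSpace (IwasawaAlgebra p)]
  [ContinuousSMul (IwasawaAlgebra p)
    (BigRepModule ℤ_[p] p (PrimaryTorsion (geomPoints (W.baseChange K)) p))]

include hp hirr hK hsplit h𝔭 hS hSp hram hκ

/-- Under the `Σ`-assumption the two duals coincide: `X^Σ(selmerBig) = X^Σ(selmerBigDecomp)` as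
types with their `Λ`-module structures (the Selmer submodules are equal), hence equal
characteristic ideals. [cite: Castella2018Erratum, §2, proof of Lemma 2.1 (p. 2)] -/
theorem charIdeal_XBig_eq_charIdeal_XBigDecomp
    (h : selmerBig_eq_selmerBigDecomp_of_unramifiedOutside) :
    XBig.charIdeal κ ((W.baseChange K).primaryTorsionGaloisRep p) 𝔭 S =
      Module.charIdeal (IwasawaAlgebra p)
        (XBigDecomp κ ((W.baseChange K).primaryTorsionGaloisRep p) 𝔭 S) := by
  have hEq := h W p hp hirr K hK hsplit 𝔭 h𝔭 S hS hSp hram κ hκ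
  unfold XBig.charIdeal XBig XBigDecomp
  rw [hEq]

/-- **`Ch_Λ(X^Σ_ac(E[p^∞])) = Ch_Λ(XBig)`**: Shapiro ([SU14, Prop. 3.2.3], the tree's
`SkinnerUrban2014.prop323_XAc_equiv_XBigDecomp`) composed with the `G_{K,S}`-identification.
[cite: SkinnerUrban2014, Prop. 3.2.3] [cite: Castella2018Erratum, §2, proof of Lemma 2.1 (p. 2)] -/
theorem charIdeal_XAc_eq_charIdeal_XBig
    (hSh : SkinnerUrban2014.prop323_XAc_equiv_XBigDecomp)
    (h : selmerBig_eq_selmerBigDecomp_of_unramifiedOutside) :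
    AcSelmer.XAc.charIdeal (W.baseChange K) p κ 𝔭 S γ =
      XBig.charIdeal κ ((W.baseChange K).primaryTorsionGaloisRep p) 𝔭 S := by
  rw [charIdeal_XBig_eq_charIdeal_XBigDecomp W p hp hirr K hK hsplit 𝔭 h𝔭 S hS hSp hram κ hκ h]
  exact SkinnerUrban2014.charIdeal_XAc_eq_charIdeal_XBigDecomp W p (by omega) K hK hsplit 𝔭 h𝔭 S
    hS hSp κ hκ γ hSh

/-- The hypothesis `hSh` of the kernel glue `XAc.map_charIdeal_le_span_of_roadFF_unr_le` for
`ψ = localMap K`, `L₀ = strictSet p 𝔭 Σ` (INERTIA indices at `w ∉ Σ`, `w ∤ p`),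
`ρf = (W.baseChange K).anticyclotomicBigRep p κ`:
`Ch_Λ(X^Σ_ac(E[p^∞])) ≤ Ch_Λ(Sel(ψ, L₀, ρf)^∨)` (with equality).
[cite: SkinnerUrban2014, Prop. 3.2.3] [cite: Castella2018Erratum, §2, proof of Lemma 2.1 (p. 2)] -/
theorem charIdeal_XAc_le_charIdeal_selmer_strictSet
    (hSh : SkinnerUrban2014.prop323_XAc_equiv_XBigDecomp)
    (h : selmerBig_eq_selmerBigDecomp_of_unramifiedOutside) :
    AcSelmer.XAc.charIdeal (W.baseChange K) p κ 𝔭 S γ ≤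
      Module.charIdeal (IwasawaAlgebra p)
        (CharacterModule
          (selmer (localMap K) (strictSet p 𝔭 S) ((W.baseChange K).anticyclotomicBigRep p κ))) :=
  (charIdeal_XAc_eq_charIdeal_XBig W p hp hirr K hK hsplit 𝔭 h𝔭 S hS hSp hram κ hκ γ hSh h).le

/-- `X^Σ_ac(E[p^∞])` is `Λ`-torsion iff `Sel(ψ, strictSet, ρf)^∨` is (the glue's `hT` transported).
[cite: SkinnerUrban2014, Prop. 3.2.3] [cite: Castella2018Erratum, §2, proof of Lemma 2.1 (p. 2)] -/
theorem isTorsion_XAc_iff_isTorsion_XBig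
    (hSh : SkinnerUrban2014.prop323_XAc_equiv_XBigDecomp)
    (h : selmerBig_eq_selmerBigDecomp_of_unramifiedOutside) :
    Module.IsTorsion (IwasawaAlgebra p) (AcSelmer.XAc (W.baseChange K) p κ 𝔭 S γ) ↔
      Module.IsTorsion (IwasawaAlgebra p)
        (XBig κ ((W.baseChange K).primaryTorsionGaloisRep p) 𝔭 S) := by
  have hEq := h W p hp hirr K hK hsplit 𝔭 h𝔭 S hS hSp hram κ hκ
  rw [SkinnerUrban2014.isTorsion_XAc_iff_isTorsion_XBigDecomp W p (by omega) K hK hsplit 𝔭 h𝔭 S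
    hS hSp κ hκ γ hSh]
  unfold XBig XBigDecomp
  rw [hEq]

/-- `X^Σ_ac(E[p^∞])` is finitely generated over `Λ` iff `Sel(ψ, strictSet, ρf)^∨` is (the glue's
`Module.Finite` instance transported). [cite: SkinnerUrban2014, Prop. 3.2.3] [cite: Castella2018Erratum, §2, proof of Lemma 2.1 (p. 2)] -/
theorem finite_XAc_iff_finite_XBig
    (hSh : SkinnerUrban2014.prop323_XAc_equiv_XBigDecomp)
    (h : selmerBig_eq_selmerBigDecomp_of_unramifiedOutside) :
    Module.Finite (IwasawaAlgebra p) (AcSelmer.XAc (W.baseChange K) p κ 𝔭 S γ) ↔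
      Module.Finite (IwasawaAlgebra p)
        (XBig κ ((W.baseChange K).primaryTorsionGaloisRep p) 𝔭 S) := by
  have hEq := h W p hp hirr K hK hsplit 𝔭 h𝔭 S hS hSp hram κ hκ
  rw [SkinnerUrban2014.finite_XAc_iff_finite_XBigDecomp W p (by omega) K hK hsplit 𝔭 h𝔭 S
    hS hSp κ hκ γ hSh]
  unfold XBig XBigDecomp
  rw [hEq]

end Corollaries

end Literature.NumberTheory.EllipticCurves.Castella2018

end
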